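import Summits.CriticalPhenomena.CardyFormulaZ2.Theorems.CardyBoundaryCoulombGasRectilinearCardyDefs
import Summits.CriticalPhenomena.CardyFormulaZ2.Theorems.CardyBoundaryCoulombGasRectilinearCardyLocalSide
import Literature.Analysis.Complex.SchwarzReflection
import Literature.Probability.LatticeModels.FlatBoundaryLatticeWindow
import HarnessLib

/-!
# Stub `stub_schwarzExtension` of line `excursion-kernel-covariance`, part 1: local reflection
# (crux `RectilinearCardy`, stmt-CriticalPhenomena-5660, route `CardyBoundaryCoulombGas`)

Geometric and analytic input for the Schwarz extension of the inverse uniformizer of a conformal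
rectangle `R = (Ω; a, b, c, d)` across the flat pieces of its boundary:

* `exists_mem_frontier_ne` — boundary points of a Jordan domain are not isolated in the frontier;
* `exists_pos_forall_frontier_param` — frontier points near `∂Ω(t)`, `S₀ < t < S`, have parameters
  in `[S₀, S]` (the loop is injective on the period `[S₀, S₀ + 1)`, `S < S₀ + 1`);
* `exists_side` — the local side of a Jordan domain at a flat boundary point `x`, in a rotated frame
  `T ζ = x + ν ζ` (`‖ν‖ = 1`, the frontier near `x` on the line `x + ν ℝ`): for `μ = ± ν` the open
  half-disc `{x + μ ζ : ‖ζ‖ < r, im ζ > 0}` lies in `Ω`, the opposite one misses `Ω̄` and the diameter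
  consists of frontier points (each half-disc is connected and misses `∂Ω`; both `Ω` and the exterior
  accumulate at `x` by the Jordan curve theorem — the tree's `frontier_subset_closure_exterior'` and
  the half-ball lemmas of `FlatBoundaryLatticeWindow`);
* `exists_differentiableOn_reflect` — Schwarz reflection in a rotated half-disc: the function equal
  to `w₀` on `Ω̄` and to `conj (w₀ (x + μ² conj (z - x)))` off `Ω̄` is holomorphic on `B(x, ρ)`
  (`Complex.differentiableOn_schwarzReflection` after the affine change of variable `T`);
* `exists_local_reflection` — the two combined at a flat boundary point `∂Ω(t)`, `t ∈ [0, mark 3]`,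
  for a function `w₀` holomorphic on `Ω`, continuous on `Ω ∪ ∂Ω([S₀, S])` and real on `∂Ω([S₀, S])`.

Reference: Conway, *Functions of One Complex Variable I* (1978), Ch. IX, Thm. 1.1.
-/

noncomputable section

open Set Filter Topology Metric
open scoped ComplexConjugate
open Literature.Probability.RandomPlanarGeometry
open Literature.Probability.LatticeModels (upperHalfBall lowerHalfBall
  upperHalfBall_subset_or_lowerHalfBall_subset upperHalfBall_subset_or_disjoint
  lowerHalfBall_subset_or_disjoint mem_closure_of_im_eq_of_upper mem_closure_of_im_eq_of_lower
  exists_add_I_mem_ball)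

namespace Summit.CriticalPhenomena.CardyFormulaZ2.Cruxes.RectilinearCardy.ExcursionKernelCovariance

/-! ### Two facts about the boundary loop -/

/-- **Boundary points of a Jordan domain are not isolated in the frontier**: for every `ε > 0` there
is a frontier point other than `∂Ω(t)` within `ε` of it (the loop is continuous, and injective on the
period `[t, t + 1)`). [folklore] -/
theorem exists_mem_frontier_ne (D : JordanDomain) (t : ℝ) {ε : ℝ} (hε : 0 < ε) :
    ∃ z ∈ frontier D.carrier, dist z (D.boundary t) < ε ∧ z ≠ D.boundary t := by
  obtain ⟨δ, hδ, hδε⟩ := Metric.continuous_iff.1 D.continuous_boundary t ε hε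
  have hh0 : 0 < min δ 1 / 2 := by positivity
  have hhδ : min δ 1 / 2 < δ := by have := min_le_left δ 1; linarith
  have hh1 : min δ 1 / 2 < 1 := by have := min_le_right δ 1; linarith
  refine ⟨D.boundary (t + min δ 1 / 2), D.boundary_mem_frontier _, hδε _ ?_, fun heq => ?_⟩
  · rw [Real.dist_eq, add_sub_cancel_left, abs_of_pos hh0]
    exact hhδ
  · have := D.injOn_boundary_Ico t ⟨by linarith, by linarith⟩ ⟨le_rfl, by linarith⟩ heq
    linarith

/-- **Frontier points near `∂Ω(t)`, `S₀ < t < S < S₀ + 1`, have parameters in `[S₀, S]`.** The arc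
`∂Ω([S, S₀ + 1])` is compact and misses `∂Ω(t)` (the loop is injective on the period
`[S₀, S₀ + 1)`), so a ball around `∂Ω(t)` misses it, and the frontier is `∂Ω([S₀, S₀ + 1])` by
periodicity. [folklore] -/
theorem exists_pos_forall_frontier_param (D : JordanDomain) {S₀ S t : ℝ} (hS : S < S₀ + 1)
    (ht₀ : S₀ < t) (htS : t < S) :
    ∃ κ : ℝ, 0 < κ ∧ ∀ z ∈ frontier D.carrier, dist z (D.boundary t) < κ →
      ∃ u ∈ Icc S₀ S, D.boundary u = z := by
  set K : Set ℂ := D.boundary '' Icc S (S₀ + 1) with hK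
  have hKc : IsClosed K := (isCompact_Icc.image D.continuous_boundary).isClosed
  have hinj : InjOn D.boundary (Ico S₀ (S₀ + 1)) := D.injOn_boundary_Ico S₀
  have htI : t ∈ Ico S₀ (S₀ + 1) := ⟨ht₀.le, by linarith⟩
  have htK : D.boundary t ∉ K := by
    rintro ⟨u, hu, hut⟩
    rcases hu.2.lt_or_eq with hlt | heq
    · have := hinj ⟨by linarith [hu.1], hlt⟩ htI hut
      linarith [hu.1]
    · rw [heq, D.periodic_boundary S₀] at hut
      have := hinj ⟨le_rfl, by linarith⟩ htI hut
      linarith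
  obtain ⟨κ, hκ, hball⟩ := Metric.mem_nhds_iff.1 (hKc.isOpen_compl.mem_nhds htK)
  refine ⟨κ, hκ, fun z hz hzd => ?_⟩
  rw [← D.range_boundary] at hz
  obtain ⟨v, rfl⟩ := hz
  obtain ⟨u, hu, hvu⟩ := D.periodic_boundary.exists_mem_Ico one_pos v S₀
  refine ⟨u, ⟨hu.1, ?_⟩, hvu.symm⟩
  by_contra hSu
  rw [not_le] at hSu
  exact hball (mem_ball.2 hzd) ⟨u, ⟨hSu.le, hu.2.le⟩, hvu.symm⟩

/-! ### The local side of a Jordan domain at a flat boundary point (rotated frame) -/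

/-- **The local side of a Jordan domain at a flat boundary point, in a rotated frame.** Let `x` be a
frontier point of the Jordan domain `D`, `ν` a unit complex number, `r > 0`, and suppose every
frontier point within `r` of `x` lies on the line `x + ν ℝ`. Then for `μ = ν` or `μ = -ν` the open
half-disc `{x + μ ζ : ‖ζ‖ < r, im ζ > 0}` lies in `D`, the opposite open half-disc misses `D̄`, and
the diameter consists of frontier points. (In the frame `T ζ = x + ν ζ` the frontier of `T⁻¹ D` near
`0` is real; each open half-disc is connected and misses it, so lies in `T⁻¹ D` or misses its
closure; both cannot lie inside since the exterior accumulates at `x` by the Jordan curve theorem,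
and one does since `x ∈ D̄`.) [folklore] -/
theorem exists_side (D : JordanDomain) {x ν : ℂ} (hx : x ∈ frontier D.carrier) (hν : ‖ν‖ = 1)
    {r : ℝ} (hr : 0 < r)
    (hflat : ∀ z ∈ frontier D.carrier, dist z x < r → (conj ν * (z - x)).im = 0) :
    ∃ μ : ℂ, (μ = ν ∨ μ = -ν) ∧
      (∀ ζ : ℂ, ‖ζ‖ < r → 0 < ζ.im → x + μ * ζ ∈ D.carrier) ∧
      (∀ ζ : ℂ, ‖ζ‖ < r → ζ.im < 0 → x + μ * ζ ∉ closure D.carrier) ∧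
      (∀ ζ : ℂ, ‖ζ‖ < r → ζ.im = 0 → x + μ * ζ ∈ frontier D.carrier) := by
  -- the rotated frame `T ζ = x + ν ζ`
  have hν0 : ν ≠ 0 := fun h => by simp [h] at hν
  have hνν : conj ν * ν = 1 := by rw [Complex.conj_mul', hν]; simp
  have hνν' : ν * conj ν = 1 := by rw [mul_comm]; exact hνν
  set T : ℂ ≃ₜ ℂ := (Homeomorph.mulLeft₀ ν hν0).trans (Homeomorph.addLeft x) with hT
  have hTapp : ∀ ζ, T ζ = x + ν * ζ := fun ζ => rfl
  set Ω' : Set ℂ := T ⁻¹' D.carrier with hΩ'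
  have hΩ'o : IsOpen Ω' := D.isOpen.preimage T.continuous
  have hfr' : frontier Ω' = T ⁻¹' frontier D.carrier := (T.preimage_frontier _).symm
  have hcl' : closure Ω' = T ⁻¹' closure D.carrier := (T.preimage_closure _).symm
  have h0 : (0 : ℂ) ∈ frontier Ω' := by
    rw [hfr', mem_preimage, hTapp, mul_zero, add_zero]
    exact hx
  have hdist : ∀ ζ, dist (x + ν * ζ) x = ‖ζ‖ := fun ζ => by
    rw [dist_eq_norm, add_sub_cancel_left, norm_mul, hν, one_mul]
  have hflat' : ∀ ζ ∈ frontier Ω', dist ζ 0 < r → ζ.im = (0 : ℂ).im := by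
    intro ζ hζ hζr
    rw [hfr', mem_preimage, hTapp] at hζ
    rw [dist_zero_right] at hζr
    have := hflat _ hζ (by rw [hdist]; exact hζr)
    rw [add_sub_cancel_left, ← mul_assoc, hνν, one_mul] at this
    rw [this, Complex.zero_im]
  -- an exterior point in the ball
  obtain ⟨e, he, hxe⟩ :=
    Metric.mem_closure_iff.1 (D.frontier_subset_closure_exterior' hx) r hr
  set e' : ℂ := conj ν * (e - x) with he'
  have hTe' : x + ν * e' = e := by rw [he', ← mul_assoc, hνν', one_mul, add_sub_cancel]
  have he'r : e' ∈ ball (0 : ℂ) r := by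
    rw [mem_ball, dist_zero_right, he', norm_mul, Complex.norm_conj, hν, one_mul, ← dist_eq_norm,
      dist_comm]
    exact hxe
  have he'c : e' ∉ closure Ω' := by
    rw [hcl', mem_preimage, hTapp, hTe']
    exact he
  have hnot : ¬ (upperHalfBall 0 r ⊆ Ω' ∧ lowerHalfBall 0 r ⊆ Ω') := by
    rintro ⟨hup, hlow⟩
    rcases lt_trichotomy 0 e'.im with hlt | heq | hgt
    · exact he'c (subset_closure (hup ⟨he'r, by simpa using hlt⟩))
    · exact he'c (mem_closure_of_im_eq_of_upper hup he'r (by rw [Complex.zero_im]; exact heq.symm))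
    · exact he'c (subset_closure (hlow ⟨he'r, by simpa using hgt⟩))
  rcases upperHalfBall_subset_or_lowerHalfBall_subset hΩ'o h0 hr hflat' with hup | hlow
  · -- `D` on the `+` side: `μ = ν`
    have hlow : Disjoint (lowerHalfBall 0 r) (closure Ω') :=
      (lowerHalfBall_subset_or_disjoint hΩ'o hflat').resolve_left fun h => hnot ⟨hup, h⟩
    refine ⟨ν, Or.inl rfl, fun ζ hζ hζi => ?_, fun ζ hζ hζi => ?_, fun ζ hζ hζi => ?_⟩
    · exact hup ⟨by rwa [mem_ball, dist_zero_right], by simpa using hζi⟩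
    · intro hc
      have : ζ ∈ closure Ω' := by rw [hcl', mem_preimage, hTapp]; exact hc
      exact hlow.ne_of_mem ⟨by rwa [mem_ball, dist_zero_right], by simpa using hζi⟩ this rfl
    · have hζb : ζ ∈ ball (0 : ℂ) r := by rwa [mem_ball, dist_zero_right]
      have hcl : ζ ∈ closure Ω' :=
        mem_closure_of_im_eq_of_upper hup hζb (by rw [hζi, Complex.zero_im])
      rw [D.isOpen.frontier_eq]
      refine ⟨by rw [hcl', mem_preimage, hTapp] at hcl; exact hcl, fun hζΩ => ?_⟩
      have hζΩ' : ζ ∈ Ω' := hζΩ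
      obtain ⟨ε, hε, hεΩ⟩ := Metric.isOpen_iff.1 hΩ'o ζ hζΩ'
      obtain ⟨η, hη0, hηε, -, hηball⟩ := exists_add_I_mem_ball hζb hε
      have hmem : ζ - η * Complex.I ∈ Ω' := hεΩ (by
        rw [mem_ball, dist_eq_norm, sub_sub_cancel_left, norm_neg, norm_mul, Complex.norm_real,
          Complex.norm_I, mul_one, Real.norm_eq_abs, abs_of_pos hη0]
        exact hηε)
      refine hlow.ne_of_mem ⟨hηball, ?_⟩ (subset_closure hmem) rfl
      show (ζ - η * Complex.I).im < (0 : ℂ).im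
      simp [hζi, hη0]
  · -- `D` on the `-` side: `μ = -ν`
    have hup : Disjoint (upperHalfBall 0 r) (closure Ω') :=
      (upperHalfBall_subset_or_disjoint hΩ'o hflat').resolve_left fun h => hnot ⟨h, hlow⟩
    have hneg : ∀ ζ : ℂ, x + -ν * ζ = x + ν * -ζ := fun ζ => by ring
    refine ⟨-ν, Or.inr rfl, fun ζ hζ hζi => ?_, fun ζ hζ hζi => ?_, fun ζ hζ hζi => ?_⟩
    · rw [hneg]
      exact hlow ⟨by rwa [mem_ball, dist_zero_right, norm_neg], by simpa using hζi⟩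
    · rw [hneg]
      intro hc
      have : -ζ ∈ closure Ω' := by rw [hcl', mem_preimage, hTapp]; exact hc
      exact hup.ne_of_mem ⟨by rwa [mem_ball, dist_zero_right, norm_neg], by simpa using hζi⟩
        this rfl
    · rw [hneg]
      have hζb : -ζ ∈ ball (0 : ℂ) r := by rwa [mem_ball, dist_zero_right, norm_neg]
      have hcl : -ζ ∈ closure Ω' :=
        mem_closure_of_im_eq_of_lower hlow hζb (by rw [Complex.neg_im, hζi, neg_zero, Complex.zero_im])
      rw [D.isOpen.frontier_eq]
      refine ⟨by rw [hcl', mem_preimage, hTapp] at hcl; exact hcl, fun hζΩ => ?_⟩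
      have hζΩ' : -ζ ∈ Ω' := hζΩ
      obtain ⟨ε, hε, hεΩ⟩ := Metric.isOpen_iff.1 hΩ'o (-ζ) hζΩ'
      obtain ⟨η, hη0, hηε, hηball, -⟩ := exists_add_I_mem_ball hζb hε
      have hmem : -ζ + η * Complex.I ∈ Ω' := hεΩ (by
        rw [mem_ball, dist_eq_norm, add_sub_cancel_left, norm_mul, Complex.norm_real,
          Complex.norm_I, mul_one, Real.norm_eq_abs, abs_of_pos hη0]
        exact hηε)
      refine hup.ne_of_mem ⟨hηball, ?_⟩ (subset_closure hmem) rfl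
      show (0 : ℂ).im < (-ζ + η * Complex.I).im
      simp [hζi, hη0]

/-! ### Schwarz reflection in a rotated half-disc -/

/-- **Schwarz reflection in a rotated half-disc.** Let `w₀` be holomorphic on `Ω ⊆ ℂ`,
`x ∈ ℂ`, `μ` a unit complex number and `ρ > 0` such that the open half-disc
`{x + μ ζ : ‖ζ‖ < ρ, im ζ > 0}` lies in `Ω`, the opposite one misses `Ω̄`, the diameter lies in `Ω̄`,
`w₀` is continuous on `Ω̄ ∩ B(x, ρ)` and real on the diameter. Then the function equal to `w₀` on
`Ω̄` and to `conj (w₀ (x + μ² conj (z - x)))` (reflection across the diameter line) off `Ω̄` is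
holomorphic on `B(x, ρ)`: it is `schwarzReflection (w₀ ∘ T) ∘ T⁻¹` for the affine isometry
`T ζ = x + μ ζ`. Conway, *Functions of One Complex Variable I*, IX.1.1.
[cite: Conway1978, Ch. IX Thm. 1.1] -/
theorem exists_differentiableOn_reflect {Ω : Set ℂ} {w₀ : ℂ → ℂ}
    (hd : DifferentiableOn ℂ w₀ Ω) {x μ : ℂ} (hμ : ‖μ‖ = 1) {ρ : ℝ}
    (hin : ∀ ζ : ℂ, ‖ζ‖ < ρ → 0 < ζ.im → x + μ * ζ ∈ Ω)
    (hout : ∀ ζ : ℂ, ‖ζ‖ < ρ → ζ.im < 0 → x + μ * ζ ∉ closure Ω)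
    (hdiam : ∀ ζ : ℂ, ‖ζ‖ < ρ → ζ.im = 0 → x + μ * ζ ∈ closure Ω)
    (hc : ContinuousOn w₀ (closure Ω ∩ ball x ρ))
    (hreal : ∀ ζ : ℂ, ‖ζ‖ < ρ → ζ.im = 0 → conj (w₀ (x + μ * ζ)) = w₀ (x + μ * ζ)) :
    ∃ G : ℂ → ℂ, DifferentiableOn ℂ G (ball x ρ) ∧
      (∀ z ∈ ball x ρ, z ∈ closure Ω → G z = w₀ z) ∧
      (∀ z ∈ ball x ρ, z ∉ closure Ω → G z = conj (w₀ (x + μ ^ 2 * conj (z - x)))) := by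
  have hμμ : conj μ * μ = 1 := by rw [Complex.conj_mul', hμ]; simp
  have hμμ' : μ * conj μ = 1 := by rw [mul_comm]; exact hμμ
  have hdist : ∀ ζ, dist (x + μ * ζ) x = ‖ζ‖ := fun ζ => by
    rw [dist_eq_norm, add_sub_cancel_left, norm_mul, hμ, one_mul]
  set f : ℂ → ℂ := fun ζ => w₀ (x + μ * ζ) with hf
  have hF : DifferentiableOn ℂ (Complex.schwarzReflection f) (ball 0 ρ) := by
    refine Complex.differentiableOn_schwarzReflection isOpen_ball (fun z hz => ?_) ?_ ?_ ?_
    · rw [mem_ball, dist_zero_right] at hz ⊢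
      rwa [Complex.norm_conj]
    · refine hc.comp (Continuous.continuousOn (by fun_prop)) ?_
      rintro ζ ⟨hζ, hζi⟩
      rw [mem_ball, dist_zero_right] at hζ
      refine ⟨?_, by rw [mem_ball, hdist]; exact hζ⟩
      rcases (show 0 ≤ ζ.im from hζi).lt_or_eq with hlt | heq
      · exact subset_closure (hin ζ hζ hlt)
      · exact hdiam ζ hζ heq.symm
    · refine hd.comp (Differentiable.differentiableOn (by fun_prop)) ?_
      rintro ζ ⟨hζ, hζi⟩
      rw [mem_ball, dist_zero_right] at hζ
      exact hin ζ hζ hζi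
    · intro ζ hζ hζi
      rw [mem_ball, dist_zero_right] at hζ
      exact hreal ζ hζ hζi
  have hback : ∀ z, x + μ * (conj μ * (z - x)) = z := fun z => by
    rw [← mul_assoc, hμμ', one_mul, add_sub_cancel]
  have hnorm : ∀ z ∈ ball x ρ, ‖conj μ * (z - x)‖ < ρ := fun z hz => by
    rw [norm_mul, Complex.norm_conj, hμ, one_mul, ← dist_eq_norm]
    exact hz
  refine ⟨fun z => Complex.schwarzReflection f (conj μ * (z - x)), ?_, ?_, ?_⟩
  · refine hF.comp (Differentiable.differentiableOn (by fun_prop)) fun z hz => ?_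
    rw [mem_ball, dist_zero_right]
    exact hnorm z hz
  · intro z hz hzc
    have him : 0 ≤ (conj μ * (z - x)).im := by
      by_contra h
      rw [not_le] at h
      exact hout _ (hnorm z hz) h (by rwa [hback])
    show Complex.schwarzReflection f _ = _
    rw [Complex.schwarzReflection_of_nonneg him, hf]
    simp only
    rw [hback]
  · intro z hz hzc
    have him : (conj μ * (z - x)).im < 0 := by
      by_contra h
      rw [not_lt] at h
      rcases h.lt_or_eq with hlt | heq
      · exact hzc (by rw [← hback z]; exact subset_closure (hin _ (hnorm z hz) hlt))
      · exact hzc (by rw [← hback z]; exact hdiam _ (hnorm z hz) heq.symm)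
    show Complex.schwarzReflection f _ = _
    rw [Complex.schwarzReflection_of_neg him, hf]
    simp only
    have harg : x + μ * conj (conj μ * (z - x)) = x + μ ^ 2 * conj (z - x) := by
      rw [map_mul, Complex.conj_conj]
      ring
    rw [harg]

/-! ### Local reflection at a flat boundary point of a conformal rectangle -/

/-- **Local Schwarz reflection at a flat boundary point.** Let `w₀` be holomorphic on `Ω`, continuous
on `Ω ∪ ∂Ω([S₀, S])` and real there (`w₀ (∂Ω(t)) = g t`), with `S₀ < 0`, `mark 3 < S < S₀ + 1`. If
`t ∈ [0, mark 3]` is a flat parameter, then for some `ρ > 0` and a sign `s = ±1` (horizontal /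
vertical side), every frontier point within `2ρ` of `x = ∂Ω(t)` is fixed by the reflection
`σ z = x + s conj (z - x)` across the side line, and some `G`, holomorphic on `B(x, ρ)`, equals `w₀`
on `B(x, ρ) ∩ Ω̄` and `conj ∘ w₀ ∘ σ` on `B(x, ρ) ∖ Ω̄` (`exists_side` + `exists_differentiableOn_reflect`
with `2ρ ≤` the flat radius and `ρ <` the radius of `exists_pos_forall_frontier_param`, so that `w₀` is
continuous up to the diameter and real on it). [cite: Conway1978, Ch. IX Thm. 1.1] -/
theorem exists_local_reflection (R : ConformalRectangle) {g : ℝ → ℝ} {S₀ S : ℝ} {w₀ : ℂ → ℂ}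
    (hS₀ : S₀ < 0) (h3S : R.mark 3 < S) (hS1 : S < S₀ + 1)
    (hd : DifferentiableOn ℂ w₀ R.carrier)
    (hc : ContinuousOn w₀ (R.carrier ∪ R.boundary '' Icc S₀ S))
    (hg : ∀ t ∈ Icc S₀ S, w₀ (R.boundary t) = g t) {t : ℝ} (ht : t ∈ Icc (0 : ℝ) (R.mark 3))
    (hflat : ∃ r : ℝ, 0 < r ∧ FlatNear R (R.boundary t) r) :
    ∃ ρ : ℝ, 0 < ρ ∧ ∃ s : ℂ, (s = 1 ∨ s = -1) ∧
      (∀ z ∈ frontier R.carrier, dist z (R.boundary t) < 2 * ρ →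
        R.boundary t + s * conj (z - R.boundary t) = z) ∧
      ∃ G : ℂ → ℂ, DifferentiableOn ℂ G (ball (R.boundary t) ρ) ∧
        (∀ z ∈ ball (R.boundary t) ρ, z ∈ closure R.carrier → G z = w₀ z) ∧
        (∀ z ∈ ball (R.boundary t) ρ, z ∉ closure R.carrier →
          G z = conj (w₀ (R.boundary t + s * conj (z - R.boundary t)))) := by
  set x := R.boundary t with hx
  obtain ⟨r, hr, hfl⟩ := hflat
  -- orientation: a unit `ν ∈ {1, I}` with the frontier near `x` on the line `x + ν ℝ`
  obtain ⟨ν, hν, hs, hflν⟩ : ∃ ν : ℂ, ‖ν‖ = 1 ∧ (ν ^ 2 = 1 ∨ ν ^ 2 = -1) ∧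
      ∀ z ∈ frontier R.carrier, dist z x < r → (conj ν * (z - x)).im = 0 := by
    unfold FlatNear at hfl
    rcases hfl with h | h
    · refine ⟨1, by simp, Or.inl (by simp), fun z hz hzr => ?_⟩
      simp [h z hz hzr]
    · refine ⟨Complex.I, by simp, Or.inr (by simp), fun z hz hzr => ?_⟩
      simp [Complex.mul_im, h z hz hzr]
  -- parameters of the frontier points near `x` lie in `[S₀, S]`
  obtain ⟨κ, hκ, hpar⟩ := exists_pos_forall_frontier_param R.toJordanDomain hS1
    (show S₀ < t by linarith [ht.1]) (lt_of_le_of_lt ht.2 h3S)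
  -- the side of `Ω`
  obtain ⟨μ, hμν, hin, hout, hdiam⟩ :=
    exists_side R.toJordanDomain (R.boundary_mem_frontier t) hν hr hflν
  have hμ : ‖μ‖ = 1 := by rcases hμν with rfl | rfl <;> simp [hν]
  have hμ2 : μ ^ 2 = ν ^ 2 := by rcases hμν with rfl | rfl <;> ring
  have hνν : conj ν * ν = 1 := by rw [Complex.conj_mul', hν]; simp
  -- the radius
  set ρ : ℝ := min r κ / 2 with hρ
  have hρ0 : 0 < ρ := by positivity
  have h2ρr : 2 * ρ ≤ r := by rw [hρ]; have := min_le_left r κ; linarith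
  have hρr : ρ ≤ r := by linarith
  have hρκ : ρ < κ := by rw [hρ]; have := min_le_right r κ; linarith
  have hdist : ∀ ζ, dist (x + μ * ζ) x = ‖ζ‖ := fun ζ => by
    rw [dist_eq_norm, add_sub_cancel_left, norm_mul, hμ, one_mul]
  -- continuity of `w₀` on `Ω̄ ∩ B(x, ρ)` and reality on the diameter
  have hcont : ContinuousOn w₀ (closure R.carrier ∩ ball x ρ) := by
    refine hc.mono ?_
    rintro z ⟨hzc, hzb⟩
    rw [closure_eq_self_union_frontier] at hzc
    rcases hzc with h | h
    · exact Or.inl h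
    · obtain ⟨u, hu, huz⟩ := hpar z h (lt_trans (mem_ball.1 hzb) hρκ)
      exact Or.inr ⟨u, hu, huz⟩
  have hreal : ∀ ζ : ℂ, ‖ζ‖ < ρ → ζ.im = 0 → conj (w₀ (x + μ * ζ)) = w₀ (x + μ * ζ) := by
    intro ζ hζ hζi
    obtain ⟨u, hu, huz⟩ := hpar _ (hdiam ζ (lt_of_lt_of_le hζ hρr) hζi)
      (by rw [hdist]; exact lt_trans hζ hρκ)
    rw [← huz, hg u hu, Complex.conj_ofReal]
  obtain ⟨G, hG, hG₁, hG₂⟩ := exists_differentiableOn_reflect hd hμ (ρ := ρ)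
    (fun ζ hζ hζi => hin ζ (lt_of_lt_of_le hζ hρr) hζi)
    (fun ζ hζ hζi => hout ζ (lt_of_lt_of_le hζ hρr) hζi)
    (fun ζ hζ hζi => frontier_subset_closure (hdiam ζ (lt_of_lt_of_le hζ hρr) hζi)) hcont hreal
  refine ⟨ρ, hρ0, ν ^ 2, hs, fun z hz hzd => ?_, G, hG, hG₁, fun z hz hzc => by rw [hG₂ z hz hzc, hμ2]⟩
  -- frontier points within `2ρ ≤ r` of `x` are fixed by the reflection across `x + ν ℝ`
  have h0 := hflν z hz (lt_of_lt_of_le hzd h2ρr)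
  have hre : conj (conj ν * (z - x)) = conj ν * (z - x) := Complex.conj_eq_iff_im.2 h0
  rw [map_mul, Complex.conj_conj] at hre
  calc x + ν ^ 2 * conj (z - x) = x + ν * (ν * conj (z - x)) := by ring
    _ = x + ν * (conj ν * (z - x)) := by rw [hre]
    _ = z := by rw [← mul_assoc, mul_comm ν, hνν, one_mul, add_sub_cancel]

end Summit.CriticalPhenomena.CardyFormulaZ2.Cruxes.RectilinearCardy.ExcursionKernelCovariance

end
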